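import Mathlib.Analysis.Complex.CauchyIntegral
import Mathlib.Analysis.SpecialFunctions.ImproperIntegrals
import Mathlib.MeasureTheory.Measure.Lebesgue.Integral
import Literature.NumberTheory.LFunctions.RieszMeanDirichlet
import Literature.NumberTheory.LFunctions.ClassicalZeroFreeRegion
import HarnessLib

/-!
# `ψ(x) = x + O(x e^{−c√log x})` from a classical zero-free region (Landau 1903 / de la Vallée-Poussin)

Topic `Literature/NumberTheory/LFunctions`. Everything in this file is PROVED.

We axiomatise (`Literature.ClassicalPsiData Λ F c C`) the analytic input of the classical proof of the
prime number theorem with de la Vallée-Poussin's error term, for a Dirichlet series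
`L(s) = ∑ Λ(n) n^{-s}` with non-negative coefficients, absolutely convergent for `σ > 1`:
`L(s) = 1/(s − 1) + F(s)` on `σ > 1`, where `F` is holomorphic on the classical region
`σ > 1 − c/log(|t| + 4)` and satisfies `|F(s)| ≤ C log(|t| + 4)` there (for `Λ` = von Mangoldt's
function this is Montgomery–Vaughan, *Multiplicative Number Theory I*, Thm. 6.7 with
`F = −ζ'/ζ − 1/(s−1)`; for `Λ = Λ_K` it is Landau 1903, §§10–11 / MV p. 267), and prove under it

* `ClassicalPsiData.abs_psi_sub_le` — **MV Theorem 6.9 (6.12) / Theorem 8.9; Landau 1903 §§5–8,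
  §§12–13**: there are `c' > 0` and `C'` with `|ψ_Λ(x) − x| ≤ C' x exp(−c' √log x)` for all
  `x ≥ 2`, `ψ_Λ(x) = ∑_{n ≤ x} Λ(n)`.

The proof is Landau's (Math. Ann. 56 (1903), Part I §§5–8), in the Riesz-mean normalisation of
MV §5.1: by Perron's formula of order one (`Literature.NumberTheory.LFunctions.RieszMean.sum_mul_sub_eq_integral_LSeries`,
absolutely convergent) `ψ₁(x) = ∑_{n ≤ x} Λ(n)(x − n) = (1/2πi)∫_{(σ₀)} L(s) x^{1+s} ds/(s(s+1))`;
the polar part `1/(s − 1)` contributes exactly `(x − 1)²/2` (`Literature.NumberTheory.LFunctions.RieszMean.integral_mainTerm`);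
in the remaining integral of `F(s) x^{1+s}/(s(s+1))` the segment `[σ₀ − iT, σ₀ + iT]` is moved to
`Re s = σ₁ = 1 − c/(2 log(T+4))` by Cauchy's theorem on a rectangle inside the region (no poles),
and with `T = exp(√log x)`, `σ₀ = 1 + 1/log x` every piece is `≪ x² exp(−c₂ √log x)`; finally
`ψ` is recovered from `ψ₁` by differencing (`ψ` is monotone since `Λ ≥ 0`), Landau §8.

The file ends with the bridge from the zero-free-region package `Literature.ClassicalZFRData Λ G η`
(`ClassicalZeroFreeRegion.lean`, MV Theorems 6.6–6.7 proved there): with `F = −G'/G` one gets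
`ClassicalPsiData`, hence `Literature.NumberTheory.LFunctions.ClassicalZFRData.abs_psi_sub_le`. Specialisations: `G = (s−1)ζ(s)`
(MV Thm. 6.9) and `G = (s − 1)ζ_K(s)` (the prime ideal theorem, MV Thm. 8.9; Landau 1903 §13).

## References

* E. Landau, *Neuer Beweis des Primzahlsatzes und Beweis des Primidealsatzes*, Math. Ann. 56
  (1903), 645–670, §§5–8, §§12–13 (`LandauMathAnn1903`).
* H. L. Montgomery, R. C. Vaughan, *Multiplicative Number Theory I. Classical Theory*, CUP 2007,
  §5.1 (5.19), §6.2 Theorem 6.9, §8.4 Theorem 8.9 (`MontgomeryVaughan2007`).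
-/

noncomputable section

open Complex Filter Set MeasureTheory Real intervalIntegral
open scoped Topology Interval

namespace Literature.NumberTheory.LFunctions

/-- **Hypotheses of the classical `ψ`-estimate** for a pair `(Λ, F)` and constants `c, C`:
`Λ ≥ 0`; `∑ Λ(n) n^{-s}` converges absolutely for `σ > 1` and equals `1/(s − 1) + F(s)` there;
`F` is holomorphic on the classical region `σ > 1 − c/log(|t| + 4)` (`c > 0`) and
`|F(s)| ≤ C log(|t| + 4)` on it. Model: `F = −ζ_K'/ζ_K − 1/(s − 1)`, `Λ = Λ_K`
(Montgomery–Vaughan Thm. 6.7 and p. 267; Landau 1903, (55) p. 668 in a weaker region).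
[cite: MontgomeryVaughan2007, Theorem 6.7 and p. 267] -/
structure ClassicalPsiData (Λ : ℕ → ℝ) (F : ℂ → ℂ) (c C : ℝ) : Prop where
  /-- `0 < c`. -/
  c_pos : 0 < c
  /-- `Λ ≥ 0`. -/
  nonneg : ∀ n, 0 ≤ Λ n
  /-- `∑ Λ(n) n^{-s}` converges absolutely for `σ > 1`. -/
  summable : ∀ s : ℂ, 1 < s.re → LSeriesSummable (fun n ↦ (Λ n : ℂ)) s
  /-- `∑ Λ(n) n^{-s} = 1/(s − 1) + F(s)` for `σ > 1`. -/
  eq : ∀ s : ℂ, 1 < s.re → LSeries (fun n ↦ (Λ n : ℂ)) s = 1 / (s - 1) + F s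
  /-- `F` is holomorphic on `σ > 1 − c/log(|t| + 4)`. -/
  differentiableOn : DifferentiableOn ℂ F {s : ℂ | 1 - c / Real.log (|s.im| + 4) < s.re}
  /-- `|F(s)| ≤ C log(|t| + 4)` on `σ > 1 − c/log(|t| + 4)`. -/
  bound : ∀ s : ℂ, 1 - c / Real.log (|s.im| + 4) < s.re → ‖F s‖ ≤ C * Real.log (|s.im| + 4)

namespace ClassicalPsiData

/-! ## The classical region `σ > 1 − c/log(|t| + 4)` -/

/-- The classical region `{s : σ > 1 − c/log(|t| + 4)}`. [cite: MontgomeryVaughan2007, Theorem 6.6] -/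
def zfr (c : ℝ) : Set ℂ := {s : ℂ | 1 - c / Real.log (|s.im| + 4) < s.re}

/-- Membership in the region, unfolded. [folklore] -/
theorem mem_zfr {c : ℝ} {s : ℂ} : s ∈ zfr c ↔ 1 - c / Real.log (|s.im| + 4) < s.re := Iff.rfl

/-- The region is open. [folklore] -/
theorem isOpen_zfr (c : ℝ) : IsOpen (zfr c) := by
  have h1 : Continuous fun s : ℂ ↦ Real.log (|s.im| + 4) :=
    ((continuous_abs.comp continuous_im).add continuous_const).log
      fun s ↦ (by positivity : (0 : ℝ) < |s.im| + 4).ne'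
  have h2 : Continuous fun s : ℂ ↦ 1 - c / Real.log (|s.im| + 4) :=
    continuous_const.sub (continuous_const.div h1 fun s ↦ (ClassicalZFRData.log_tau_pos _).ne')
  exact isOpen_lt h2 continuous_re

/-- Points with `σ ≥ 1` lie in the region (`c > 0`). [folklore] -/
theorem mem_zfr_of_one_le_re {c : ℝ} (hc : 0 < c) {s : ℂ} (hs : 1 ≤ s.re) : s ∈ zfr c := by
  rw [mem_zfr]
  have : 0 < c / Real.log (|s.im| + 4) := div_pos hc (ClassicalZFRData.log_tau_pos _)
  linarith

/-- The regions increase with `c`. [folklore] -/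
theorem zfr_mono {c c' : ℝ} (h : c' ≤ c) : zfr c' ⊆ zfr c := by
  intro s hs
  rw [mem_zfr] at hs ⊢
  have : c' / Real.log (|s.im| + 4) ≤ c / Real.log (|s.im| + 4) :=
    div_le_div_of_nonneg_right h (ClassicalZFRData.log_tau_pos _).le
  linarith

/-- A closed rectangle `σ ≥ 1 − c'/log(T + 4)`, `|t| ≤ T` with `0 ≤ c' < c` lies in the region.
[folklore] -/
theorem mem_zfr_of_rect {c c' T : ℝ} (hc' : 0 ≤ c') (hc'c : c' < c) {s : ℂ}
    (hre : 1 - c' / Real.log (T + 4) ≤ s.re) (him : |s.im| ≤ T) : s ∈ zfr c := by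
  rw [mem_zfr]
  have hℓs : 0 < Real.log (|s.im| + 4) := ClassicalZFRData.log_tau_pos _
  have hℓT : Real.log (|s.im| + 4) ≤ Real.log (T + 4) :=
    Real.log_le_log (by positivity) (by linarith)
  have hTpos : 0 < Real.log (T + 4) := hℓs.trans_le hℓT
  have hc : 0 ≤ c := hc'.trans hc'c.le
  have h1 : c / Real.log (T + 4) ≤ c / Real.log (|s.im| + 4) :=
    div_le_div_of_nonneg_left hc hℓs hℓT
  have h2 : c' / Real.log (T + 4) < c / Real.log (T + 4) := div_lt_div_of_pos_right hc'c hTpos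
  linarith

/-! ## The kernel `1/(s(s+1))` and the integrand `x^{1+s} F(s)/(s(s+1))` -/

/-- The Riesz kernel of order one, `1/(s(s+1))` (MV (5.19) with `k = 1`). [cite: MontgomeryVaughan2007, §5.1 (5.19)] -/
def kernel (s : ℂ) : ℂ := 1 / (s * (s + 1))

/-- The contour integrand `Φ_x(s) = x^{1+s} F(s)/(s(s+1))` of Landau's method.
[cite: LandauMathAnn1903, §5] -/
def Phi (F : ℂ → ℂ) (x : ℝ) (s : ℂ) : ℂ := (x : ℂ) ^ (1 + s) * F s * kernel s

/-- `‖Φ_x(s)‖ = x^{1+σ} ‖F(s)‖ ‖1/(s(s+1))‖` for `x > 0`. [folklore] -/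
theorem norm_Phi_eq (F : ℂ → ℂ) {x : ℝ} (hx : 0 < x) (s : ℂ) :
    ‖Phi F x s‖ = x ^ (1 + s.re) * ‖F s‖ * ‖kernel s‖ := by
  simp only [Phi, norm_mul, norm_cpow_eq_rpow_re_of_pos hx, add_re, one_re]

/-- `‖1/(s(s+1))‖ ≤ 1/(σ² + t²)` for `s = σ + it`, `σ > 0`. [folklore] -/
theorem norm_kernel_le {σ : ℝ} (hσ : 0 < σ) (t : ℝ) :
    ‖kernel (σ + t * I)‖ ≤ 1 / (σ ^ 2 + t ^ 2) :=
  Literature.NumberTheory.LFunctions.norm_kernel_le hσ t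

/-- `‖1/(s(s+1))‖ ≤ 1/t²` for `t = Im s ≠ 0`. [folklore] -/
theorem norm_kernel_le_inv_sq {s : ℂ} (hs : s.im ≠ 0) : ‖kernel s‖ ≤ 1 / s.im ^ 2 := by
  simp only [kernel, norm_div, norm_one, norm_mul]
  have h1 : |s.im| ≤ ‖s‖ := abs_im_le_norm s
  have h2 : |s.im| ≤ ‖s + 1‖ := by simpa using abs_im_le_norm (s + 1)
  have hpos : 0 < |s.im| := abs_pos.2 hs
  rw [← sq_abs, sq]
  exact one_div_le_one_div_of_le (by positivity) (mul_le_mul h1 h2 hpos.le (norm_nonneg _))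

/-- `‖1/(s(s+1))‖ ≤ 4/(1 + t²)` for `s = σ + it`, `σ ≥ 1/2`. [folklore] -/
theorem norm_kernel_le_four_div {σ : ℝ} (hσ : 1 / 2 ≤ σ) (t : ℝ) :
    ‖kernel (σ + t * I)‖ ≤ 4 * (1 + t ^ 2)⁻¹ := by
  have hσ2 : 1 / 4 ≤ σ ^ 2 := by nlinarith
  calc ‖kernel (σ + t * I)‖ ≤ 1 / (σ ^ 2 + t ^ 2) := norm_kernel_le (by linarith) t
    _ ≤ 1 / ((1 + t ^ 2) / 4) :=
        one_div_le_one_div_of_le (by positivity) (by linarith [sq_nonneg t])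
    _ = 4 * (1 + t ^ 2)⁻¹ := by rw [one_div_div, div_eq_mul_inv]

/-- `Φ_x` is holomorphic wherever `F` is and `Re s > 0` (`x > 0`). [folklore] -/
theorem differentiableAt_Phi {F : ℂ → ℂ} {x : ℝ} (hx : 0 < x) {s : ℂ} (hF : DifferentiableAt ℂ F s)
    (hs : 0 < s.re) : DifferentiableAt ℂ (Phi F x) s := by
  have hx0 : (x : ℂ) ≠ 0 := ofReal_ne_zero.2 hx.ne'
  have h1 : DifferentiableAt ℂ (fun s : ℂ ↦ (x : ℂ) ^ (1 + s)) s :=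
    ((differentiableAt_id).const_add 1).const_cpow (Or.inl hx0)
  have hs0 : s ≠ 0 := fun h ↦ by simp [h] at hs
  have hs1 : s + 1 ≠ 0 := fun h ↦ by
    have := congrArg Complex.re h; simp at this; linarith
  have h3 : DifferentiableAt ℂ kernel s := by
    unfold kernel
    exact (differentiableAt_const _).div (differentiableAt_id.mul (differentiableAt_id.add_const 1))
      (mul_ne_zero hs0 hs1)
  exact (h1.mul hF).mul h3

variable {Λ : ℕ → ℝ} {F : ℂ → ℂ} {c C : ℝ}

/-- The constant `C` of `ClassicalPsiData` is non-negative (evaluate the bound at `s = 2`). [folklore] -/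
theorem C_nonneg (h : ClassicalPsiData Λ F c C) : 0 ≤ C := by
  have h2 : (2 : ℂ) ∈ zfr c := mem_zfr_of_one_le_re h.c_pos (by norm_num)
  have hb := h.bound 2 h2
  have hℓ : 0 < Real.log (|(2:ℂ).im| + 4) := ClassicalZFRData.log_tau_pos _
  exact (mul_nonneg_iff_of_pos_right hℓ).1 ((norm_nonneg _).trans hb)

/-- `‖F(s)‖ ≤ C log(T + 4)` for `s` in the region with `|Im s| ≤ T`. [folklore] -/
theorem norm_F_le_of_abs_im_le (h : ClassicalPsiData Λ F c C) {s : ℂ} (hs : s ∈ zfr c) {T : ℝ}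
    (hT : |s.im| ≤ T) : ‖F s‖ ≤ C * Real.log (T + 4) := by
  refine (h.bound s hs).trans ?_
  exact mul_le_mul_of_nonneg_left (Real.log_le_log (by positivity) (by linarith)) h.C_nonneg

/-! ## Perron's formula for `ψ₁` minus its main term -/

/-- Integrability on a vertical line `Re s = σ > 0` of `x^{1+s} L(f, s)/(s(s+1))` when
`∑ |f(n)| n^{-σ} < ∞` (the integrand of Perron's formula of order one). [cite: MontgomeryVaughan2007, §5.1 (5.19)] -/
theorem integrable_cpow_mul_LSeries_mul_kernel (f : ℕ → ℂ) {x : ℝ} (hx : 0 < x) {σ : ℝ}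
    (hσ : 0 < σ) (hsum : LSeriesSummable f σ) :
    Integrable fun t : ℝ ↦ (x : ℂ) ^ (1 + (σ + t * I)) * LSeries f (σ + t * I) *
      kernel (σ + t * I) := by
  set u : ℕ → ℝ := fun n ↦ x ^ (1 + σ) * ‖LSeries.term f σ n‖ with hu
  have hsu : Summable u := (hsum.norm).mul_left _
  set G : ℕ → ℝ → ℂ := fun n t ↦ (x : ℂ) ^ (1 + (σ + t * I)) * LSeries.term f (σ + t * I) n
  have hGc : ∀ n, Continuous (G n) := fun n ↦ RieszMean.continuous_cpow_mul_term f hx σ n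
  have hGn : ∀ n t, ‖G n t‖ ≤ u n := fun n t ↦ (RieszMean.norm_cpow_mul_term f hx σ t n).le
  have hcont : Continuous fun t ↦ ∑' n, G n t := continuous_tsum hGc hsu hGn
  have heq : ∀ t : ℝ, (x : ℂ) ^ (1 + (σ + t * I)) * LSeries f (σ + t * I) = ∑' n, G n t := by
    intro t
    rw [LSeries, ← tsum_mul_left]
  have hbd : ∀ t : ℝ, ‖(x : ℂ) ^ (1 + (σ + t * I)) * LSeries f (σ + t * I)‖ ≤ ∑' n, u n := by
    intro t
    rw [heq t]
    exact tsum_of_norm_bounded hsu.hasSum (hGn · t)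
  refine (Literature.NumberTheory.LFunctions.integrable_kernel hσ).bdd_mul (c := ∑' n, u n) ?_ (Eventually.of_forall hbd)
  exact (hcont.congr fun t ↦ (heq t).symm).aestronglyMeasurable

/-- Integrability on `Re s = σ > 1` of the polar part `x^{1+s}/((s−1)s(s+1))`. [folklore] -/
theorem integrable_cpow_mul_polar_mul_kernel {x : ℝ} (hx : 0 < x) {σ : ℝ} (hσ : 1 < σ) :
    Integrable fun t : ℝ ↦ (x : ℂ) ^ (1 + (σ + t * I)) * (1 / (σ + t * I - 1)) *
      kernel (σ + t * I) := by
  have hx0 : (x : ℂ) ≠ 0 := ofReal_ne_zero.2 hx.ne'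
  have hne : ∀ t : ℝ, (σ : ℂ) + t * I - 1 ≠ 0 := fun t h ↦ by
    have := congrArg Complex.re h; simp at this; linarith
  refine (Literature.NumberTheory.LFunctions.integrable_kernel (by linarith : 0 < σ)).bdd_mul (c := x ^ (1 + σ) / (σ - 1)) ?_
    (Eventually.of_forall fun t ↦ ?_)
  · refine Continuous.aestronglyMeasurable (Continuous.mul ?_ ?_)
    · refine continuous_iff_continuousAt.2 fun t ↦ ?_
      exact (continuousAt_const_cpow hx0).comp (f := fun t : ℝ ↦ 1 + ((σ : ℂ) + t * I))
        (by fun_prop)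
    · exact continuous_const.div (by fun_prop) hne
  · have hre : ((σ : ℂ) + t * I - 1).re = σ - 1 := by simp
    have hnorm : σ - 1 ≤ ‖(σ : ℂ) + t * I - 1‖ := by
      calc σ - 1 = ((σ : ℂ) + t * I - 1).re := hre.symm
        _ ≤ _ := re_le_norm _
    have h1σ : (1 + ((σ : ℂ) + t * I)).re = 1 + σ := by simp
    rw [norm_mul, norm_div, norm_one, norm_cpow_eq_rpow_re_of_pos hx, h1σ,
      div_eq_mul_one_div (x ^ (1 + σ))]
    exact mul_le_mul_of_nonneg_left (one_div_le_one_div_of_le (by linarith) hnorm)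
      (by positivity)

/-- Integrability on `Re s = σ > 1` of `Φ_x(s) = x^{1+s} F(s)/(s(s+1))` under `ClassicalPsiData`
(difference of the two previous integrands). [folklore] -/
theorem integrable_Phi (h : ClassicalPsiData Λ F c C) {x : ℝ} (hx : 0 < x) {σ : ℝ} (hσ : 1 < σ) :
    Integrable fun t : ℝ ↦ Phi F x (σ + t * I) := by
  have hs : LSeriesSummable (fun n ↦ (Λ n : ℂ)) (σ : ℂ) := h.summable _ (by simp [hσ])
  refine ((integrable_cpow_mul_LSeries_mul_kernel _ hx (by linarith) hs).sub
    (integrable_cpow_mul_polar_mul_kernel hx hσ)).congr (Eventually.of_forall fun t ↦ ?_)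
  simp only [Phi, Pi.sub_apply]
  rw [h.eq _ (by simp [hσ])]
  ring

/-- **Perron's formula for `ψ₁` with the main term removed** (Landau 1903 §5; MV (5.19)):
for `x ≥ 1` and `σ > 1`,
`∑_{n ≤ x} Λ(n)(x − n) − (x − 1)²/2 = (1/2π) ∫_{−∞}^{∞} x^{1+s} F(s)/(s(s+1)) dt`, `s = σ + it`.
[cite: LandauMathAnn1903, §5] -/
theorem rieszMean_sub_mainTerm_eq (h : ClassicalPsiData Λ F c C) {x : ℝ} (hx : 1 ≤ x) {σ : ℝ}
    (hσ : 1 < σ) :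
    ((∑ n ∈ Finset.Ioc 0 ⌊x⌋₊, Λ n * (x - n) : ℝ) : ℂ) - ((((x - 1) ^ 2 / 2 : ℝ)) : ℂ) =
      (1 / (2 * π) : ℂ) * ∫ t : ℝ, Phi F x (σ + t * I) := by
  have hx0 : 0 < x := by linarith
  have hs : LSeriesSummable (fun n ↦ (Λ n : ℂ)) (σ : ℂ) := h.summable _ (by simp [hσ])
  rw [RieszMean.sum_mul_sub_eq_integral_LSeries_real Λ hx0 (by linarith) hs,
    ← RieszMean.integral_mainTerm hx hσ, ← mul_sub, ← MeasureTheory.integral_sub]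
  · congr 1
    refine integral_congr_ae (Eventually.of_forall fun t ↦ ?_)
    simp only [Phi, kernel]
    rw [h.eq _ (by simp [hσ])]
    ring
  · exact (integrable_cpow_mul_LSeries_mul_kernel _ hx0 (by linarith) hs).congr
      (Eventually.of_forall fun t ↦ by simp only [kernel])
  · exact (integrable_cpow_mul_polar_mul_kernel hx0 hσ).congr
      (Eventually.of_forall fun t ↦ by simp only [kernel])

/-! ## Moving the segment `[σ₀ − iT, σ₀ + iT]` to `Re s = σ₁` -/

/-- **Cauchy's theorem on the rectangle `[σ₁, σ₀] × [−T, T]`** inside the region: the line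
integral over `Re s = σ₀` equals the two tails `|t| ≥ T`, plus the integral over the left side
`Re s = σ₁`, plus `i` times (bottom side minus top side). [cite: LandauMathAnn1903, §6] -/
theorem integral_line_eq (h : ClassicalPsiData Λ F c C) {x : ℝ} (hx : 0 < x) {σ₀ σ₁ T c' : ℝ}
    (hc' : 0 ≤ c') (hc'c : c' < c) (hT : 0 < T) (hσ₁ : 0 < σ₁) (hσ₁₀ : σ₁ ≤ σ₀)
    (hσ₁c : 1 - c' / Real.log (T + 4) ≤ σ₁)
    (hint : Integrable fun t : ℝ ↦ Phi F x (σ₀ + t * I)) :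
    ∫ t : ℝ, Phi F x (σ₀ + t * I) =
      (∫ t in Iic (-T), Phi F x (σ₀ + t * I)) + (∫ t in Ioi T, Phi F x (σ₀ + t * I)) +
      (∫ t in (-T)..T, Phi F x (σ₁ + t * I)) +
      I * (∫ u in σ₁..σ₀, Phi F x (u + (-T) * I)) - I * (∫ u in σ₁..σ₀, Phi F x (u + T * I)) := by
  have hsplit1 := integral_Iic_add_Ioi (b := -T) hint.integrableOn hint.integrableOn
  have hsplit2 := integral_interval_add_Ioi (a := -T) (b := T) hint.integrableOn hint.integrableOn
  -- Cauchy–Goursat on the rectangle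
  have hdiff : DifferentiableOn ℂ (Phi F x) (uIcc σ₁ σ₀ ×ℂ uIcc (-T) T) := by
    intro s hs
    rw [uIcc_of_le hσ₁₀, uIcc_of_le (by linarith : -T ≤ T)] at hs
    obtain ⟨⟨hre1, -⟩, him1, him2⟩ := hs
    have hsz : s ∈ zfr c := mem_zfr_of_rect hc' hc'c (hσ₁c.trans hre1) (abs_le.2 ⟨him1, him2⟩)
    exact (differentiableAt_Phi hx (h.differentiableOn.differentiableAt
      ((isOpen_zfr c).mem_nhds hsz)) (hσ₁.trans_le hre1)).differentiableWithinAt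
  have H := Complex.integral_boundary_rect_eq_zero_of_differentiableOn (Phi F x) ⟨σ₁, -T⟩ ⟨σ₀, T⟩
    hdiff
  dsimp only at H
  simp only [smul_eq_mul, ofReal_neg, neg_mul] at H ⊢
  have key : (∫ y : ℝ in (-T)..T, Phi F x (σ₀ + y * I)) =
      (∫ y : ℝ in (-T)..T, Phi F x (σ₁ + y * I)) +
        I * (∫ u : ℝ in σ₁..σ₀, Phi F x (u + -(T * I))) -
        I * (∫ u : ℝ in σ₁..σ₀, Phi F x (u + T * I)) := by
    have hI : I * I = -1 := I_mul_I
    linear_combination (-I) * H +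
      ((∫ y : ℝ in (-T)..T, Phi F x (σ₀ + y * I)) -
        (∫ y : ℝ in (-T)..T, Phi F x (σ₁ + y * I))) * hI
  rw [← hsplit1, ← hsplit2, key]
  ring

/-! ## Bounds for the five pieces -/

/-- `log(|t| + 4) ≤ 5 |t|^{1/2}` for `|t| ≥ 1` (crude: `log u ≤ 2√u`). [folklore] -/
theorem log_tau_le_rpow {t : ℝ} (ht : 1 ≤ |t|) : Real.log (|t| + 4) ≤ 5 * |t| ^ (1 / 2 : ℝ) := by
  have h1 : Real.log (|t| + 4) ≤ (|t| + 4) ^ (1 / 2 : ℝ) / (1 / 2) :=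
    Real.log_le_rpow_div (by positivity) (by norm_num)
  have h2 : (|t| + 4) ^ (1 / 2 : ℝ) ≤ (5 * |t|) ^ (1 / 2 : ℝ) :=
    Real.rpow_le_rpow (by positivity) (by linarith) (by norm_num)
  have h3 : (5 * |t|) ^ (1 / 2 : ℝ) = (5:ℝ) ^ (1 / 2 : ℝ) * |t| ^ (1 / 2 : ℝ) :=
    Real.mul_rpow (by norm_num) (abs_nonneg t)
  have h4 : (5:ℝ) ^ (1 / 2 : ℝ) ≤ 5 / 2 := by
    rw [← Real.sqrt_eq_rpow, Real.sqrt_le_left (by norm_num)]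
    norm_num
  have h5 : 0 ≤ |t| ^ (1 / 2 : ℝ) := by positivity
  calc Real.log (|t| + 4) ≤ 2 * (5 * |t|) ^ (1 / 2 : ℝ) := by linarith
    _ = 2 * (5:ℝ) ^ (1 / 2 : ℝ) * |t| ^ (1 / 2 : ℝ) := by rw [h3]; ring
    _ ≤ 2 * (5 / 2) * |t| ^ (1 / 2 : ℝ) := by gcongr
    _ = 5 * |t| ^ (1 / 2 : ℝ) := by ring

/-- **Pointwise bound on the line `Re s = σ₀ ≥ 1` for `|t| ≥ 1`**:
`‖Φ_x(σ₀ + it)‖ ≤ 5 C x^{1+σ₀} |t|^{−3/2}` (`x ≥ 1`). [folklore] -/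
theorem norm_Phi_le_tail (h : ClassicalPsiData Λ F c C) {x : ℝ} (hx : 1 ≤ x) {σ₀ : ℝ}
    (hσ₀ : 1 ≤ σ₀) {t : ℝ} (ht : 1 ≤ |t|) :
    ‖Phi F x (σ₀ + t * I)‖ ≤ 5 * C * x ^ (1 + σ₀) * |t| ^ (-(3 / 2 : ℝ)) := by
  have hx0 : 0 < x := by linarith
  have ht0 : 0 < |t| := by linarith
  have htne : t ≠ 0 := abs_pos.1 ht0
  have hmem : ((σ₀ : ℂ) + t * I) ∈ zfr c := mem_zfr_of_one_le_re h.c_pos (by simp [hσ₀])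
  have hF : ‖F (σ₀ + t * I)‖ ≤ C * (5 * |t| ^ (1 / 2 : ℝ)) := by
    refine (h.bound _ hmem).trans ?_
    have : ((σ₀ : ℂ) + t * I).im = t := by simp
    rw [this]
    exact mul_le_mul_of_nonneg_left (log_tau_le_rpow ht) h.C_nonneg
  have hK : ‖kernel (σ₀ + t * I)‖ ≤ |t| ^ (-(2 : ℝ)) := by
    refine (norm_kernel_le_inv_sq (s := σ₀ + t * I) (by simpa using htne)).trans (le_of_eq ?_)
    have : ((σ₀ : ℂ) + t * I).im = t := by simp
    rw [this, Real.rpow_neg (abs_nonneg t), Real.rpow_two, sq_abs, one_div]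
  rw [norm_Phi_eq F hx0]
  have hre : ((σ₀ : ℂ) + t * I).re = σ₀ := by simp
  rw [hre]
  have hsplit : |t| ^ (-(3 / 2 : ℝ)) = |t| ^ (1 / 2 : ℝ) * |t| ^ (-(2 : ℝ)) := by
    rw [← Real.rpow_add ht0]; norm_num
  have hC := h.C_nonneg
  calc x ^ (1 + σ₀) * ‖F (σ₀ + t * I)‖ * ‖kernel (σ₀ + t * I)‖
      ≤ x ^ (1 + σ₀) * (C * (5 * |t| ^ (1 / 2 : ℝ))) * |t| ^ (-(2 : ℝ)) := by
        gcongr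
    _ = 5 * C * x ^ (1 + σ₀) * |t| ^ (-(3 / 2 : ℝ)) := by rw [hsplit]; ring

/-- **The upper tail**: `‖∫_T^∞ Φ_x(σ₀ + it) dt‖ ≤ 10 C x^{1+σ₀} T^{−1/2}` for `T ≥ 1`.
[cite: LandauMathAnn1903, §6] -/
theorem norm_integral_Ioi_le (h : ClassicalPsiData Λ F c C) {x : ℝ} (hx : 1 ≤ x) {σ₀ : ℝ}
    (hσ₀ : 1 ≤ σ₀) {T : ℝ} (hT : 1 ≤ T) :
    ‖∫ t in Ioi T, Phi F x (σ₀ + t * I)‖ ≤ 10 * C * x ^ (1 + σ₀) * T ^ (-(1 / 2 : ℝ)) := by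
  have hT0 : 0 < T := by linarith
  set g : ℝ → ℝ := fun t ↦ 5 * C * x ^ (1 + σ₀) * t ^ (-(3 / 2 : ℝ)) with hg
  have hgi : IntegrableOn g (Ioi T) :=
    (integrableOn_Ioi_rpow_of_lt (by norm_num : (-(3 / 2 : ℝ)) < -1) hT0).const_mul _
  have hbound : ∀ᵐ t : ℝ ∂(volume.restrict (Ioi T)), ‖Phi F x (σ₀ + t * I)‖ ≤ g t := by
    refine (ae_restrict_iff' measurableSet_Ioi).2 (Eventually.of_forall fun t (ht : T < t) ↦ ?_)
    have ht1 : 1 ≤ |t| := by rw [abs_of_pos (hT0.trans ht)]; linarith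
    have := norm_Phi_le_tail h hx hσ₀ ht1
    rwa [abs_of_pos (hT0.trans ht)] at this
  refine (norm_integral_le_of_norm_le hgi hbound).trans (le_of_eq ?_)
  rw [hg, MeasureTheory.integral_const_mul, integral_Ioi_rpow_of_lt (by norm_num) hT0]
  have : (-(3 / 2 : ℝ)) + 1 = -(1 / 2 : ℝ) := by norm_num
  rw [this]
  ring

/-- **The lower tail**: `‖∫_{−∞}^{−T} Φ_x(σ₀ + it) dt‖ ≤ 10 C x^{1+σ₀} T^{−1/2}` for `T ≥ 1`
(reflect `t ↦ −t`). [cite: LandauMathAnn1903, §6] -/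
theorem norm_integral_Iic_le (h : ClassicalPsiData Λ F c C) {x : ℝ} (hx : 1 ≤ x) {σ₀ : ℝ}
    (hσ₀ : 1 ≤ σ₀) {T : ℝ} (hT : 1 ≤ T) :
    ‖∫ t in Iic (-T), Phi F x (σ₀ + t * I)‖ ≤ 10 * C * x ^ (1 + σ₀) * T ^ (-(1 / 2 : ℝ)) := by
  have hT0 : 0 < T := by linarith
  rw [← integral_comp_neg_Ioi]
  set g : ℝ → ℝ := fun t ↦ 5 * C * x ^ (1 + σ₀) * t ^ (-(3 / 2 : ℝ)) with hg
  have hgi : IntegrableOn g (Ioi T) :=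
    (integrableOn_Ioi_rpow_of_lt (by norm_num : (-(3 / 2 : ℝ)) < -1) hT0).const_mul _
  have hbound : ∀ᵐ t : ℝ ∂(volume.restrict (Ioi T)),
      ‖Phi F x (σ₀ + ((-t : ℝ) : ℂ) * I)‖ ≤ g t := by
    refine (ae_restrict_iff' measurableSet_Ioi).2 (Eventually.of_forall fun t (ht : T < t) ↦ ?_)
    have ht1 : 1 ≤ |(-t)| := by rw [abs_neg, abs_of_pos (hT0.trans ht)]; linarith
    have := norm_Phi_le_tail h hx hσ₀ ht1
    rwa [abs_neg, abs_of_pos (hT0.trans ht)] at this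
  refine (norm_integral_le_of_norm_le hgi hbound).trans (le_of_eq ?_)
  rw [hg, MeasureTheory.integral_const_mul, integral_Ioi_rpow_of_lt (by norm_num) hT0]
  have : (-(3 / 2 : ℝ)) + 1 = -(1 / 2 : ℝ) := by norm_num
  rw [this]
  ring

/-- **The horizontal sides** `[σ₁, σ₀] × {±T}` of the rectangle:
`‖∫_{σ₁}^{σ₀} Φ_x(u ± iT) du‖ ≤ C log(T+4) x^{1+σ₀} (σ₀ − σ₁)/T²`. [cite: LandauMathAnn1903, §6] -/
theorem norm_integral_horizontal_le (h : ClassicalPsiData Λ F c C) {x : ℝ} (hx : 1 ≤ x)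
    {σ₀ σ₁ T c' : ℝ} (hc' : 0 ≤ c') (hc'c : c' < c) (hT : 0 < T) (hσ₁₀ : σ₁ ≤ σ₀)
    (hσ₁c : 1 - c' / Real.log (T + 4) ≤ σ₁) {T' : ℝ} (hT' : |T'| = T) :
    ‖∫ u in σ₁..σ₀, Phi F x (u + T' * I)‖ ≤
      C * Real.log (T + 4) * x ^ (1 + σ₀) / T ^ 2 * (σ₀ - σ₁) := by
  have hx0 : 0 < x := by linarith
  have hT'0 : T' ≠ 0 := by rintro rfl; simp at hT'; linarith
  have hb : ∀ u ∈ Ι σ₁ σ₀, ‖Phi F x (u + T' * I)‖ ≤ C * Real.log (T + 4) * x ^ (1 + σ₀) / T ^ 2 := by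
    intro u hu
    rw [uIoc_of_le hσ₁₀] at hu
    have him : ((u : ℂ) + T' * I).im = T' := by simp
    have hre : ((u : ℂ) + T' * I).re = u := by simp
    have hmem : ((u : ℂ) + T' * I) ∈ zfr c :=
      mem_zfr_of_rect hc' hc'c (by rw [hre]; linarith [hu.1]) (by rw [him, hT'])
    have hF : ‖F (u + T' * I)‖ ≤ C * Real.log (T + 4) :=
      h.norm_F_le_of_abs_im_le hmem (by rw [him, hT'])
    have hK : ‖kernel (u + T' * I)‖ ≤ 1 / T ^ 2 := by
      have := norm_kernel_le_inv_sq (s := u + T' * I) (by rw [him]; exact hT'0)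
      rwa [him, ← sq_abs, hT'] at this
    have hxu : x ^ (1 + u) ≤ x ^ (1 + σ₀) :=
      Real.rpow_le_rpow_of_exponent_le hx (by linarith [hu.2])
    rw [norm_Phi_eq F hx0, hre]
    have hC := h.C_nonneg
    have hlog : 0 ≤ Real.log (T + 4) := Real.log_nonneg (by linarith)
    calc x ^ (1 + u) * ‖F (u + T' * I)‖ * ‖kernel (u + T' * I)‖
        ≤ x ^ (1 + σ₀) * (C * Real.log (T + 4)) * (1 / T ^ 2) := by
          gcongr
      _ = C * Real.log (T + 4) * x ^ (1 + σ₀) / T ^ 2 := by ring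
  have := intervalIntegral.norm_integral_le_of_norm_le_const hb
  rwa [abs_of_nonneg (sub_nonneg.2 hσ₁₀)] at this

/-- **The left side** `Re s = σ₁` of the rectangle (`σ₁ ≥ 1/2`):
`‖∫_{−T}^{T} Φ_x(σ₁ + it) dt‖ ≤ 4π C log(T+4) x^{1+σ₁}` (using `∫ dt/(1+t²) = π`).
[cite: LandauMathAnn1903, §6] -/
theorem norm_integral_left_le (h : ClassicalPsiData Λ F c C) {x : ℝ} (hx : 1 ≤ x) {σ₁ T c' : ℝ}
    (hc' : 0 ≤ c') (hc'c : c' < c) (hT : 0 < T) (hσ₁ : 1 / 2 ≤ σ₁)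
    (hσ₁c : 1 - c' / Real.log (T + 4) ≤ σ₁) :
    ‖∫ t in (-T)..T, Phi F x (σ₁ + t * I)‖ ≤ 4 * π * C * Real.log (T + 4) * x ^ (1 + σ₁) := by
  have hx0 : 0 < x := by linarith
  have hC := h.C_nonneg
  have hlog : 0 ≤ Real.log (T + 4) := Real.log_nonneg (by linarith)
  set M : ℝ := 4 * C * Real.log (T + 4) * x ^ (1 + σ₁) with hM
  have hM0 : 0 ≤ M := by positivity
  set g : ℝ → ℝ := fun t ↦ M * (1 + t ^ 2)⁻¹ with hg
  have hgi : Integrable g := integrable_inv_one_add_sq.const_mul M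
  have hb : ∀ᵐ t : ℝ, t ∈ Ioc (-T) T → ‖Phi F x (σ₁ + t * I)‖ ≤ g t := by
    refine Eventually.of_forall fun t ht ↦ ?_
    have him : ((σ₁ : ℂ) + t * I).im = t := by simp
    have hre : ((σ₁ : ℂ) + t * I).re = σ₁ := by simp
    have htT : |t| ≤ T := abs_le.2 ⟨ht.1.le, ht.2⟩
    have hmem : ((σ₁ : ℂ) + t * I) ∈ zfr c :=
      mem_zfr_of_rect hc' hc'c (by rw [hre]; exact hσ₁c) (by rw [him]; exact htT)
    have hF : ‖F (σ₁ + t * I)‖ ≤ C * Real.log (T + 4) :=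
      h.norm_F_le_of_abs_im_le hmem (by rw [him]; exact htT)
    have hK := norm_kernel_le_four_div hσ₁ t
    rw [norm_Phi_eq F hx0, hre, hg]
    calc x ^ (1 + σ₁) * ‖F (σ₁ + t * I)‖ * ‖kernel (σ₁ + t * I)‖
        ≤ x ^ (1 + σ₁) * (C * Real.log (T + 4)) * (4 * (1 + t ^ 2)⁻¹) := by
          gcongr
      _ = M * (1 + t ^ 2)⁻¹ := by rw [hM]; ring
  have h1 := intervalIntegral.norm_integral_le_of_norm_le (by linarith : -T ≤ T) hb
    (hgi.intervalIntegrable)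
  refine h1.trans ?_
  rw [intervalIntegral.integral_of_le (by linarith : -T ≤ T)]
  calc ∫ t in Ioc (-T) T, g t ≤ ∫ t, g t :=
        setIntegral_le_integral hgi (Eventually.of_forall fun t ↦ by simp only [hg]; positivity)
    _ = M * π := by rw [hg, MeasureTheory.integral_const_mul, integral_univ_inv_one_add_sq]
    _ = 4 * π * C * Real.log (T + 4) * x ^ (1 + σ₁) := by rw [hM]; ring

/-! ## The estimate for the Riesz mean `ψ₁` -/

/-- Triangle inequality for the five pieces. [folklore] -/
theorem norm_add_add_add_sub_le (a b d e f : ℂ) :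
    ‖a + b + d + e - f‖ ≤ ‖a‖ + ‖b‖ + ‖d‖ + ‖e‖ + ‖f‖ := by
  calc ‖a + b + d + e - f‖ ≤ ‖a + b + d + e‖ + ‖f‖ := norm_sub_le _ _
    _ ≤ ‖a + b + d‖ + ‖e‖ + ‖f‖ := by gcongr; exact norm_add_le _ _
    _ ≤ ‖a + b‖ + ‖d‖ + ‖e‖ + ‖f‖ := by gcongr; exact norm_add_le _ _
    _ ≤ ‖a‖ + ‖b‖ + ‖d‖ + ‖e‖ + ‖f‖ := by gcongr; exact norm_add_le _ _

/-- **Landau's estimate for the Riesz mean** (Landau 1903 §7 for `ζ`, §12 for `ζ_K`, there with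
the weaker `exp(−(log x)^{1/γ})`; with the classical region one gets MV's exponent): under
`ClassicalPsiData Λ F c C`, for `x ≥ 3`,
`|∑_{n ≤ x} Λ(n)(x − n) − (x − 1)²/2| ≤ C₃ x² exp(−c₂ √log x)`, `c₂ = min(c, 1/2)/12`.
Parameters: `σ₀ = 1 + 1/log x`, `T = exp(√log x)`, `σ₁ = 1 − min(c,1/2)/(4 log(T + 4))`.
[cite: LandauMathAnn1903, §7 and §12] -/
theorem abs_rieszMean_sub_le (h : ClassicalPsiData Λ F c C) :
    ∃ C₃ : ℝ, 0 ≤ C₃ ∧ ∀ x : ℝ, 3 ≤ x →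
      |(∑ n ∈ Finset.Ioc 0 ⌊x⌋₊, Λ n * (x - n)) - (x - 1) ^ 2 / 2| ≤
        C₃ * x ^ 2 * Real.exp (-(min c (1 / 2) / 12 * Real.sqrt (Real.log x))) := by
  set c₁ : ℝ := min c (1 / 2) with hc₁
  have hc₁pos : 0 < c₁ := lt_min h.c_pos (by norm_num)
  have hc₁c : c₁ ≤ c := min_le_left _ _
  have hc₁h : c₁ ≤ 1 / 2 := min_le_right _ _
  have hC := h.C_nonneg
  have hc₂pos : 0 < c₁ / 12 := by positivity
  refine ⟨C * (32 * Real.exp 1 + 12 * π / (c₁ / 12)), by positivity, fun x hx ↦ ?_⟩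
  set c₂ : ℝ := c₁ / 12 with hc₂
  have hc₂h : c₂ ≤ 1 / 24 := by rw [hc₂]; linarith
  -- parameters
  have hx1 : 1 ≤ x := by linarith
  have hx0 : 0 < x := by linarith
  set L : ℝ := Real.log x with hL
  have hL1 : 1 ≤ L := by
    rw [hL, ← Real.log_exp 1]
    exact Real.log_le_log (Real.exp_pos 1) (by linarith [Real.exp_one_lt_d9])
  have hL0 : 0 < L := by linarith
  set lam : ℝ := Real.sqrt L with hlam
  have hlam1 : 1 ≤ lam := Real.one_le_sqrt.2 hL1
  have hlam0 : 0 < lam := by linarith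
  have hlamsq : lam ^ 2 = L := Real.sq_sqrt hL0.le
  set T : ℝ := Real.exp lam with hT
  have hT1 : 1 ≤ T := Real.one_le_exp hlam0.le
  have hT0 : 0 < T := by linarith
  have hlogT : Real.log T = lam := Real.log_exp lam
  set ℓ : ℝ := Real.log (T + 4) with hℓ
  have hℓlam : lam ≤ ℓ := by rw [← hlogT, hℓ]; exact Real.log_le_log hT0 (by linarith)
  have hℓ1 : 1 ≤ ℓ := hlam1.trans hℓlam
  have hℓ0 : 0 < ℓ := by linarith
  have hℓle : ℓ ≤ 3 * lam := by
    have h5 : Real.log (T + 4) ≤ Real.log (Real.exp 2 * T) := by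
      refine Real.log_le_log (by linarith) ?_
      have he : (5 : ℝ) ≤ Real.exp 2 := by
        have h1 := Real.exp_one_gt_d9
        have h' : Real.exp 2 = Real.exp 1 * Real.exp 1 := by rw [← Real.exp_add]; norm_num
        rw [h']
        calc (5 : ℝ) ≤ 2.7182818283 * 2.7182818283 := by norm_num
          _ ≤ Real.exp 1 * Real.exp 1 :=
              mul_le_mul h1.le h1.le (by norm_num) (Real.exp_pos 1).le
      have := mul_le_mul_of_nonneg_right he hT0.le
      linarith
    rw [Real.log_mul (Real.exp_pos 2).ne' hT0.ne', Real.log_exp, hlogT] at h5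
    linarith
  set σ₀ : ℝ := 1 + 1 / L with hσ₀
  have hσ₀1 : 1 < σ₀ := by
    have : 0 < 1 / L := by positivity
    rw [hσ₀]; linarith
  have hσ₀2 : σ₀ ≤ 2 := by rw [hσ₀]; have := (div_le_one hL0).2 hL1; linarith
  set c' : ℝ := c₁ / 2 with hc'
  have hc'0 : 0 ≤ c' := by positivity
  have hc'c : c' < c := by linarith
  have hc'ℓ0 : 0 ≤ c' / ℓ := by positivity
  have hc'ℓ : c' / ℓ ≤ 1 / 4 := by rw [div_le_iff₀ hℓ0]; linarith
  set σ₁ : ℝ := 1 - c' / ℓ with hσ₁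
  have hσ₁34 : 3 / 4 ≤ σ₁ := by linarith
  have hσ₁1 : σ₁ ≤ 1 := by linarith
  have hσ₁0 : 0 < σ₁ := by linarith
  have hσ₁₀ : σ₁ ≤ σ₀ := by linarith
  have hσ₁c : 1 - c' / Real.log (T + 4) ≤ σ₁ := le_rfl
  -- powers of `x` and `T`
  have hxσ₀ : x ^ (1 + σ₀) = Real.exp 1 * x ^ 2 := by
    rw [hσ₀, show (1 : ℝ) + (1 + 1 / L) = 2 + 1 / L by ring, Real.rpow_add hx0, Real.rpow_two,
      Real.rpow_def_of_pos hx0, ← hL, mul_one_div_cancel hL0.ne', mul_comm]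
  have hxσ₁ : x ^ (1 + σ₁) ≤ x ^ 2 * Real.exp (-(2 * c₂ * lam)) := by
    rw [hσ₁, show (1 : ℝ) + (1 - c' / ℓ) = 2 + (-(c' / ℓ)) by ring, Real.rpow_add hx0,
      Real.rpow_two, Real.rpow_def_of_pos hx0, ← hL]
    have key : 2 * c₂ * lam ≤ L * (c' / ℓ) := by
      rw [mul_div_assoc' L, le_div_iff₀ hℓ0, ← hlamsq, hc', hc₂]
      have hprod := mul_le_mul_of_nonneg_left hℓle (mul_pos hc₁pos hlam0).le
      linarith
    have : L * -(c' / ℓ) ≤ -(2 * c₂ * lam) := by linarith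
    exact mul_le_mul_of_nonneg_left (Real.exp_le_exp.2 this) (by positivity)
  have hTpow : T ^ (-(1 / 2 : ℝ)) = Real.exp (-(lam / 2)) := by
    rw [hT, ← Real.exp_mul]; congr 1; ring
  have hT2 : 1 / T ^ 2 = Real.exp (-(2 * lam)) := by
    rw [hT, sq, ← Real.exp_add, Real.exp_neg, one_div]; congr 1; ring_nf
  -- exponential comparisons
  have hc₂lam : c₂ * lam ≤ 1 / 24 * lam := mul_le_mul_of_nonneg_right hc₂h hlam0.le
  have e1 : Real.exp (-(lam / 2)) ≤ Real.exp (-(c₂ * lam)) :=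
    Real.exp_le_exp.2 (by linarith)
  have e2 : lam * Real.exp (-(2 * c₂ * lam)) ≤ Real.exp (-(c₂ * lam)) / c₂ := by
    rw [le_div_iff₀ hc₂pos]
    have h1 : c₂ * lam ≤ Real.exp (c₂ * lam) := by linarith [Real.add_one_le_exp (c₂ * lam)]
    have h2 : Real.exp (c₂ * lam) * Real.exp (-(2 * c₂ * lam)) = Real.exp (-(c₂ * lam)) := by
      rw [← Real.exp_add]; ring_nf
    calc lam * Real.exp (-(2 * c₂ * lam)) * c₂ = (c₂ * lam) * Real.exp (-(2 * c₂ * lam)) := by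
          ring
      _ ≤ Real.exp (c₂ * lam) * Real.exp (-(2 * c₂ * lam)) := by gcongr
      _ = Real.exp (-(c₂ * lam)) := h2
  have e3 : lam * Real.exp (-(2 * lam)) ≤ Real.exp (-(c₂ * lam)) := by
    have h1 : lam ≤ Real.exp lam := by linarith [Real.add_one_le_exp lam]
    have h2 : Real.exp lam * Real.exp (-(2 * lam)) = Real.exp (-lam) := by
      rw [← Real.exp_add]; ring_nf
    calc lam * Real.exp (-(2 * lam)) ≤ Real.exp lam * Real.exp (-(2 * lam)) := by gcongr
      _ = Real.exp (-lam) := h2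
      _ ≤ Real.exp (-(c₂ * lam)) := Real.exp_le_exp.2 (by linarith)
  -- Perron, Cauchy, and the five bounds
  have hint := h.integrable_Phi hx0 hσ₀1
  have hA := h.rieszMean_sub_mainTerm_eq hx1 hσ₀1
  have hsplit := h.integral_line_eq hx0 hc'0 hc'c hT0 hσ₁0 hσ₁₀ hσ₁c hint
  have b1 := h.norm_integral_Iic_le hx1 hσ₀1.le hT1
  have b2 := h.norm_integral_Ioi_le hx1 hσ₀1.le hT1
  have b3 := h.norm_integral_left_le hx1 hc'0 hc'c hT0 (by linarith : 1 / 2 ≤ σ₁) hσ₁c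
  have b4 := h.norm_integral_horizontal_le hx1 hc'0 hc'c hT0 hσ₁₀ hσ₁c (T' := -T)
    (by rw [abs_neg, abs_of_pos hT0])
  have b5 := h.norm_integral_horizontal_le hx1 hc'0 hc'c hT0 hσ₁₀ hσ₁c (T' := T) (abs_of_pos hT0)
  simp only [ofReal_neg, neg_mul] at b4 hsplit
  -- sizes of the pieces
  have s12 : 10 * C * x ^ (1 + σ₀) * T ^ (-(1 / 2 : ℝ)) ≤
      10 * C * Real.exp 1 * x ^ 2 * Real.exp (-(c₂ * lam)) := by
    rw [hxσ₀, hTpow]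
    calc 10 * C * (Real.exp 1 * x ^ 2) * Real.exp (-(lam / 2))
        = (10 * C * Real.exp 1 * x ^ 2) * Real.exp (-(lam / 2)) := by ring
      _ ≤ (10 * C * Real.exp 1 * x ^ 2) * Real.exp (-(c₂ * lam)) :=
          mul_le_mul_of_nonneg_left e1 (by positivity)
  have s3 : 4 * π * C * Real.log (T + 4) * x ^ (1 + σ₁) ≤
      12 * π * C * x ^ 2 * (Real.exp (-(c₂ * lam)) / c₂) := by
    calc 4 * π * C * Real.log (T + 4) * x ^ (1 + σ₁)
        ≤ 4 * π * C * (3 * lam) * (x ^ 2 * Real.exp (-(2 * c₂ * lam))) := by gcongr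
      _ = 12 * π * C * x ^ 2 * (lam * Real.exp (-(2 * c₂ * lam))) := by ring
      _ ≤ 12 * π * C * x ^ 2 * (Real.exp (-(c₂ * lam)) / c₂) := by gcongr
  have s45 : C * Real.log (T + 4) * x ^ (1 + σ₀) / T ^ 2 * (σ₀ - σ₁) ≤
      6 * Real.exp 1 * C * x ^ 2 * Real.exp (-(c₂ * lam)) := by
    rw [hxσ₀, div_eq_mul_one_div _ (T ^ 2), hT2]
    calc C * Real.log (T + 4) * (Real.exp 1 * x ^ 2) * Real.exp (-(2 * lam)) * (σ₀ - σ₁)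
        ≤ C * (3 * lam) * (Real.exp 1 * x ^ 2) * Real.exp (-(2 * lam)) * 2 := by
          gcongr
          · linarith
      _ = 6 * Real.exp 1 * C * x ^ 2 * (lam * Real.exp (-(2 * lam))) := by ring
      _ ≤ 6 * Real.exp 1 * C * x ^ 2 * Real.exp (-(c₂ * lam)) := by gcongr
  -- the norm of the line integral
  have hI : ∀ z : ℂ, ‖I * z‖ = ‖z‖ := fun z ↦ by rw [norm_mul, norm_I, one_mul]
  have hline : ‖∫ t : ℝ, Phi F x (σ₀ + t * I)‖ ≤
      C * (32 * Real.exp 1 + 12 * π / c₂) * x ^ 2 * Real.exp (-(c₂ * lam)) := by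
    rw [hsplit]
    refine (norm_add_add_add_sub_le _ _ _ _ _).trans ?_
    rw [hI, hI]
    have := add_le_add (add_le_add (add_le_add (add_le_add (b1.trans s12) (b2.trans s12))
      (b3.trans s3)) (b4.trans s45)) (b5.trans s45)
    refine this.trans (le_of_eq ?_)
    field_simp
    ring
  -- conclusion
  have hreal : (((∑ n ∈ Finset.Ioc 0 ⌊x⌋₊, Λ n * (x - n)) - (x - 1) ^ 2 / 2 : ℝ) : ℂ) =
      (1 / (2 * π) : ℂ) * ∫ t : ℝ, Phi F x (σ₀ + t * I) := by
    rw [← hA]; push_cast; ring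
  rw [← Real.norm_eq_abs, ← Complex.norm_real, hreal, norm_mul]
  have h2π : ‖(1 / (2 * π) : ℂ)‖ ≤ 1 := by
    rw [show (1 / (2 * π) : ℂ) = ((1 / (2 * π) : ℝ) : ℂ) by push_cast; ring, Complex.norm_real,
      Real.norm_eq_abs, abs_of_pos (by positivity)]
    rw [div_le_one (by positivity)]
    linarith [Real.two_le_pi]
  calc ‖(1 / (2 * π) : ℂ)‖ * ‖∫ t : ℝ, Phi F x (σ₀ + t * I)‖
      ≤ 1 * (C * (32 * Real.exp 1 + 12 * π / c₂) * x ^ 2 * Real.exp (-(c₂ * lam))) := by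
        gcongr
    _ = C * (32 * Real.exp 1 + 12 * π / c₂) * x ^ 2 * Real.exp (-(c₂ * lam)) := one_mul _

/-! ## From `ψ₁` to `ψ`: differencing (Landau 1903 §8) -/

/-- `ψ_Λ(x) = ∑_{n ≤ x} Λ(n)`. [cite: LandauMathAnn1903, §8] -/
def psi (Λ : ℕ → ℝ) (x : ℝ) : ℝ := ∑ n ∈ Finset.Ioc 0 ⌊x⌋₊, Λ n

/-- The Riesz mean `ψ₁(x) = ∑_{n ≤ x} Λ(n)(x − n) = ∫₀ˣ ψ_Λ(u) du`. [cite: LandauMathAnn1903, §5] -/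
def rieszMean (Λ : ℕ → ℝ) (x : ℝ) : ℝ := ∑ n ∈ Finset.Ioc 0 ⌊x⌋₊, Λ n * (x - n)

/-- `ψ_Λ` is monotone for `Λ ≥ 0`. [folklore] -/
theorem psi_mono (hΛ : ∀ n, 0 ≤ Λ n) : Monotone (psi Λ) := fun _ _ hxy ↦
  RieszMean.sum_Ioc_floor_mono hΛ hxy

/-- `ψ_Λ ≥ 0` for `Λ ≥ 0`. [folklore] -/
theorem psi_nonneg (hΛ : ∀ n, 0 ≤ Λ n) (x : ℝ) : 0 ≤ psi Λ x :=
  RieszMean.sum_Ioc_floor_nonneg hΛ x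

/-- Lower differencing inequality `(y − x) ψ(x) ≤ ψ₁(y) − ψ₁(x)` (`0 ≤ x ≤ y`).
[cite: LandauMathAnn1903, §8] -/
theorem sub_mul_psi_le (hΛ : ∀ n, 0 ≤ Λ n) {x y : ℝ} (hy : 0 ≤ y) (hxy : x ≤ y) :
    (y - x) * psi Λ x ≤ rieszMean Λ y - rieszMean Λ x :=
  RieszMean.sub_mul_sum_le_sub hΛ hy hxy

/-- Upper differencing inequality `ψ₁(y) − ψ₁(x) ≤ (y − x) ψ(y)` (`x ≤ y`).
[cite: LandauMathAnn1903, §8] -/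
theorem rieszMean_sub_le (hΛ : ∀ n, 0 ≤ Λ n) {x y : ℝ} (hxy : x ≤ y) :
    rieszMean Λ y - rieszMean Λ x ≤ (y - x) * psi Λ y :=
  RieszMean.sub_le_sub_mul_sum hΛ hxy

/-- `√(log x) − 1 ≤ √(log y)` for `x ≥ 6` and `y ≥ x/2`. [folklore] -/
theorem sqrt_log_sub_one_le {x y : ℝ} (hx : 6 ≤ x) (hy : x / 2 ≤ y) :
    Real.sqrt (Real.log x) - 1 ≤ Real.sqrt (Real.log y) := by
  have hx0 : 0 < x := by linarith
  have hLy : Real.log x - 1 ≤ Real.log y := by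
    have h1 := Real.log_le_log (by linarith) hy
    rw [Real.log_div hx0.ne' two_ne_zero] at h1
    linarith [Real.log_two_lt_d9]
  have hL1 : 1 ≤ Real.log x := by
    rw [← Real.log_exp 1]
    exact Real.log_le_log (Real.exp_pos 1) (by linarith [Real.exp_one_lt_d9])
  have hsL : 1 ≤ Real.sqrt (Real.log x) := Real.one_le_sqrt.2 hL1
  have hsq : Real.sqrt (Real.log x) ^ 2 = Real.log x := Real.sq_sqrt (by linarith)
  calc Real.sqrt (Real.log x) - 1 ≤ Real.sqrt (Real.log x - 1) := by
        rw [Real.le_sqrt (by linarith) (by linarith)]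
        nlinarith
    _ ≤ Real.sqrt (Real.log y) := Real.sqrt_le_sqrt hLy

/-- The `ψ₁`-estimate recentred at `x²/2`: for `y ≥ 3`,
`|ψ₁(y) − y²/2| ≤ C₄ y² exp(−c₂ √log y)` (absorb `y − 1/2 ≤ y ≤ y² e^{−c₂√log y}`).
[cite: LandauMathAnn1903, §7] -/
theorem abs_rieszMean_sub_sq_le (h : ClassicalPsiData Λ F c C) :
    ∃ C₄ : ℝ, 0 ≤ C₄ ∧ ∀ y : ℝ, 3 ≤ y →
      |rieszMean Λ y - y ^ 2 / 2| ≤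
        C₄ * y ^ 2 * Real.exp (-(min c (1 / 2) / 12 * Real.sqrt (Real.log y))) := by
  obtain ⟨C₃, hC₃, hψ₁⟩ := h.abs_rieszMean_sub_le
  have hc₂ : min c (1 / 2) / 12 ≤ 1 := by have := min_le_right c (1 / 2); linarith
  refine ⟨C₃ + 1, by positivity, fun y hy ↦ ?_⟩
  have hy0 : 0 < y := by linarith
  set c₂ : ℝ := min c (1 / 2) / 12
  set lam : ℝ := Real.sqrt (Real.log y) with hlam
  have h1 : |rieszMean Λ y - (y - 1) ^ 2 / 2| ≤ C₃ * y ^ 2 * Real.exp (-(c₂ * lam)) := hψ₁ y hy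
  have hL1 : 1 ≤ Real.log y := by
    rw [← Real.log_exp 1]
    exact Real.log_le_log (Real.exp_pos 1) (by linarith [Real.exp_one_lt_d9])
  have hl1 : 1 ≤ lam := Real.one_le_sqrt.2 hL1
  have h2 : y ≤ y ^ 2 * Real.exp (-(c₂ * lam)) := by
    have hsq : lam ^ 2 = Real.log y := Real.sq_sqrt (by linarith)
    have h4 : c₂ * lam ≤ 1 * lam := mul_le_mul_of_nonneg_right hc₂ (by linarith)
    have h4' : lam * 1 ≤ lam * lam := mul_le_mul_of_nonneg_left hl1 (by linarith)
    have h3 : c₂ * lam ≤ Real.log y := by nlinarith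
    have h5 : Real.exp (c₂ * lam) ≤ y := by
      calc Real.exp (c₂ * lam) ≤ Real.exp (Real.log y) := Real.exp_le_exp.2 h3
        _ = y := Real.exp_log hy0
    rw [Real.exp_neg, ← div_eq_mul_inv, le_div_iff₀ (Real.exp_pos _), sq]
    exact mul_le_mul_of_nonneg_left h5 hy0.le
  have h3 : |rieszMean Λ y - y ^ 2 / 2| ≤ |rieszMean Λ y - (y - 1) ^ 2 / 2| + y := by
    have : rieszMean Λ y - y ^ 2 / 2 = (rieszMean Λ y - (y - 1) ^ 2 / 2) - (y - 1 / 2) := by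
      ring
    rw [this]
    refine (abs_sub _ _).trans ?_
    rw [abs_of_pos (by linarith : 0 < y - 1 / 2)]
    linarith
  calc |rieszMean Λ y - y ^ 2 / 2|
      ≤ C₃ * y ^ 2 * Real.exp (-(c₂ * lam)) + y ^ 2 * Real.exp (-(c₂ * lam)) := by
        linarith [h1, h2, h3]
    _ = (C₃ + 1) * y ^ 2 * Real.exp (-(c₂ * lam)) := by ring

/-- **The classical `ψ`-estimate** (de la Vallée-Poussin 1899 for `ζ`; Landau 1903, §8 and §13
for `ζ_K`, with a weaker exponent; Montgomery–Vaughan Theorem 6.9 (6.12) / Theorem 8.9): under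
`ClassicalPsiData Λ F c C` there are `c' > 0` and `C'` with
`|∑_{n ≤ x} Λ(n) − x| ≤ C' x exp(−c' √log x)` for all `x ≥ 2` (here `c' = min(c, 1/2)/24`).
From the `ψ₁`-estimate by differencing with `h = ½ x exp(−c' √log x)`:
`h ψ(x) ≤ ψ₁(x + h) − ψ₁(x)` and `ψ₁(x) − ψ₁(x − h) ≤ h ψ(x)`.
[cite: MontgomeryVaughan2007, Theorem 6.9 (6.12)] -/
theorem abs_psi_sub_le (h : ClassicalPsiData Λ F c C) :
    ∃ c' : ℝ, 0 < c' ∧ ∃ C' : ℝ, ∀ x : ℝ, 2 ≤ x →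
      |(∑ n ∈ Finset.Ioc 0 ⌊x⌋₊, Λ n) - x| ≤
        C' * x * Real.exp (-c' * Real.sqrt (Real.log x)) := by
  obtain ⟨C₄, hC₄, hE⟩ := h.abs_rieszMean_sub_sq_le
  set c₂ : ℝ := min c (1 / 2) / 12 with hc₂
  have hc₂pos : 0 < c₂ := by have := h.c_pos; positivity
  have hc₂le : c₂ ≤ 1 / 24 := by have := min_le_right c (1 / 2); rw [hc₂]; linarith
  have hΛ := h.nonneg
  have hψ6 := psi_nonneg hΛ 6
  have he6 : (6 : ℝ) ≤ Real.exp 2 := by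
    have h1 := Real.exp_one_gt_d9
    have h' : Real.exp 2 = Real.exp 1 * Real.exp 1 := by rw [← Real.exp_add]; norm_num
    rw [h']
    calc (6 : ℝ) ≤ 2.7182818283 * 2.7182818283 := by norm_num
      _ ≤ Real.exp 1 * Real.exp 1 := mul_le_mul h1.le h1.le (by norm_num) (Real.exp_pos 1).le
  refine ⟨c₂ / 2, by positivity, (1 / 4 + 8 * C₄) + (psi Λ 6 + 6) * (Real.exp 2 / 2),
    fun x hx ↦ ?_⟩
  show |psi Λ x - x| ≤ _
  have hx0 : 0 < x := by linarith
  set lam : ℝ := Real.sqrt (Real.log x) with hlam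
  have hlam0 : 0 ≤ lam := Real.sqrt_nonneg _
  set u : ℝ := Real.exp (-(c₂ / 2) * lam) with hu
  have hu0 : 0 < u := Real.exp_pos _
  have hu1 : u ≤ 1 := Real.exp_le_one_iff.2 (by nlinarith)
  have hpos1 : 0 ≤ (1 / 4 + 8 * C₄) * x * u := by positivity
  have hpos2 : 0 ≤ (psi Λ 6 + 6) * (Real.exp 2 / 2) * x * u := by positivity
  rcases lt_or_ge x 6 with hx6 | hx6
  · -- small `x`: `ψ` is bounded by `ψ(6)`
    have hψx : psi Λ x ≤ psi Λ 6 := psi_mono hΛ hx6.le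
    have hψ0 := psi_nonneg hΛ x
    have h1 : |psi Λ x - x| ≤ psi Λ 6 + 6 := by rw [abs_le]; constructor <;> linarith
    have hlam2 : lam ≤ 2 := by
      rw [hlam, Real.sqrt_le_left (by norm_num)]
      have : Real.log x ≤ Real.log (Real.exp 2) := Real.log_le_log hx0 (by linarith)
      rw [Real.log_exp] at this
      linarith
    have h2 : Real.exp (-2) ≤ u := by
      refine Real.exp_le_exp.2 ?_
      have : c₂ / 2 * lam ≤ 1 * 2 := mul_le_mul (by linarith) hlam2 hlam0 (by norm_num)
      linarith
    have h4 : (1 : ℝ) ≤ Real.exp 2 / 2 * x * u := by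
      calc (1 : ℝ) = Real.exp 2 / 2 * 2 * Real.exp (-2) := by rw [Real.exp_neg]; field_simp
        _ ≤ Real.exp 2 / 2 * x * u := by gcongr
    calc |psi Λ x - x| ≤ (psi Λ 6 + 6) * 1 := by linarith
      _ ≤ (psi Λ 6 + 6) * (Real.exp 2 / 2 * x * u) :=
          mul_le_mul_of_nonneg_left h4 (by linarith)
      _ = (psi Λ 6 + 6) * (Real.exp 2 / 2) * x * u := by ring
      _ ≤ ((1 / 4 + 8 * C₄) + (psi Λ 6 + 6) * (Real.exp 2 / 2)) * x * u := by linarith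
  · -- `x ≥ 6`: differencing with `h = x u / 2`
    have hx3 : (3 : ℝ) ≤ x := by linarith
    have huu : Real.exp (-(c₂ * lam)) = u * u := by rw [hu, ← Real.exp_add]; ring_nf
    have hxu : x * u / 2 ≤ x / 2 := by nlinarith
    have hxu0 : 0 < x * u / 2 := by positivity
    have hEx : |rieszMean Λ x - x ^ 2 / 2| ≤ C₄ * x ^ 2 * (u * u) := by rw [← huu]; exact hE x hx3
    -- upper bound, `y = x + xu/2`
    have hup : psi Λ x - x ≤ (1 / 4 + 8 * C₄) * x * u := by
      have hy3 : 3 ≤ x + x * u / 2 := by linarith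
      have hxy : x ≤ x + x * u / 2 := by linarith
      have hd := sub_mul_psi_le hΛ (by linarith : 0 ≤ x + x * u / 2) hxy
      have hEy : |rieszMean Λ (x + x * u / 2) - (x + x * u / 2) ^ 2 / 2| ≤
          C₄ * (9 / 4 * x ^ 2) * (u * u) := by
        refine (hE _ hy3).trans ?_
        have hl : Real.exp (-(c₂ * Real.sqrt (Real.log (x + x * u / 2)))) ≤ u * u := by
          rw [← huu]
          refine Real.exp_le_exp.2 ?_
          have := Real.sqrt_le_sqrt (Real.log_le_log hx0 hxy)
          have := mul_le_mul_of_nonneg_left this hc₂pos.le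
          linarith
        have hy2 : (x + x * u / 2) ^ 2 ≤ 9 / 4 * x ^ 2 := by nlinarith
        have hfin : C₄ * (x + x * u / 2) ^ 2 *
            Real.exp (-(c₂ * Real.sqrt (Real.log (x + x * u / 2)))) ≤
            C₄ * (9 / 4 * x ^ 2) * (u * u) := by gcongr
        exact hfin
      have a1 := (abs_le.1 hEy).2
      have a2 := (abs_le.1 hEx).1
      have key : (x * u / 2) * (psi Λ x - x) ≤ (x * u / 2) * ((1 / 4 + 8 * C₄) * x * u) := by
        have hsq : 0 ≤ C₄ * (x * u) ^ 2 := by positivity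
        nlinarith [hd, a1, a2, hsq]
      exact le_of_mul_le_mul_left key hxu0
    -- lower bound, `y = x − xu/2`
    have hlow : -((1 / 4 + 8 * C₄) * x * u) ≤ psi Λ x - x := by
      have hy3 : 3 ≤ x - x * u / 2 := by linarith
      have hyx : x - x * u / 2 ≤ x := by linarith
      have hd := rieszMean_sub_le hΛ hyx
      have hEy : |rieszMean Λ (x - x * u / 2) - (x - x * u / 2) ^ 2 / 2| ≤
          C₄ * x ^ 2 * (3 * (u * u)) := by
        refine (hE _ hy3).trans ?_
        have hl : Real.exp (-(c₂ * Real.sqrt (Real.log (x - x * u / 2)))) ≤ 3 * (u * u) := by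
          have hs := sqrt_log_sub_one_le hx6 (by linarith : x / 2 ≤ x - x * u / 2)
          have hs' := mul_le_mul_of_nonneg_left hs hc₂pos.le
          have he3 : Real.exp c₂ ≤ 3 :=
            ((Real.exp_le_exp.2 (by linarith : c₂ ≤ 1)).trans Real.exp_one_lt_d9.le).trans
              (by norm_num)
          calc Real.exp (-(c₂ * Real.sqrt (Real.log (x - x * u / 2))))
              ≤ Real.exp (c₂ + -(c₂ * lam)) := Real.exp_le_exp.2 (by linarith)
            _ = Real.exp c₂ * (u * u) := by rw [Real.exp_add, huu]
            _ ≤ 3 * (u * u) := by gcongr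
        have hy2 : (x - x * u / 2) ^ 2 ≤ x ^ 2 := by nlinarith
        have hfin : C₄ * (x - x * u / 2) ^ 2 *
            Real.exp (-(c₂ * Real.sqrt (Real.log (x - x * u / 2)))) ≤
            C₄ * x ^ 2 * (3 * (u * u)) := by gcongr
        exact hfin
      have a1 := (abs_le.1 hEy).2
      have a2 := (abs_le.1 hEx).1
      have key : (x * u / 2) * (-((1 / 4 + 8 * C₄) * x * u)) ≤ (x * u / 2) * (psi Λ x - x) := by
        linarith [hd, a1, a2]
      exact le_of_mul_le_mul_left key hxu0
    calc |psi Λ x - x| ≤ (1 / 4 + 8 * C₄) * x * u := abs_le.2 ⟨hlow, hup⟩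
      _ ≤ ((1 / 4 + 8 * C₄) + (psi Λ 6 + 6) * (Real.exp 2 / 2)) * x * u := by linarith

end ClassicalPsiData

/-! ## From the zero-free-region package `ClassicalZFRData` to the `ψ`-estimate -/

namespace ClassicalZFRData

variable {Λ : ℕ → ℝ} {G : ℂ → ℂ} {η : ℝ}

/-- **MV Theorems 6.6–6.7 feed Theorem 6.9**: under `ClassicalZFRData Λ G η` (zero-free region and
`G'/G ≪ log τ` proved in `ClassicalZeroFreeRegion.lean`), `F = −G'/G` satisfies
`ClassicalPsiData Λ F c C` with `c = min(c₆.₇, η/2)` (so that the classical region lies inside the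
half-plane `σ > 1 − η` where `G` lives) and the constant `C` of Theorem 6.7.
[cite: MontgomeryVaughan2007, Theorems 6.6–6.7] -/
theorem classicalPsiData (h : ClassicalZFRData Λ G η) :
    ∃ c C : ℝ, ClassicalPsiData Λ (fun s ↦ -(deriv G s / G s)) c C := by
  obtain ⟨c, hc, C, -, hreg⟩ := h.norm_logDeriv_le
  have hη := h.eta_pos
  set c₀ : ℝ := min c (η / 2) with hc₀
  have hc₀pos : 0 < c₀ := lt_min hc (by positivity)
  have hsub : ∀ s : ℂ, 1 - c₀ / Real.log (|s.im| + 4) < s.re →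
      1 - η < s.re ∧ 1 - c / Real.log (|s.im| + 4) ≤ s.re := by
    intro s hs
    have hℓ := ClassicalZFRData.one_le_log_tau s.im
    have hℓ0 : 0 < Real.log (|s.im| + 4) := by linarith
    have h1 : c₀ / Real.log (|s.im| + 4) ≤ c / Real.log (|s.im| + 4) :=
      div_le_div_of_nonneg_right (min_le_left _ _) hℓ0.le
    have h2 : c₀ / Real.log (|s.im| + 4) ≤ η / 2 := by
      calc c₀ / Real.log (|s.im| + 4) ≤ c₀ / 1 :=
            div_le_div_of_nonneg_left hc₀pos.le one_pos hℓ
        _ ≤ η / 2 := by rw [div_one]; exact min_le_right _ _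
    constructor <;> linarith
  have hopen : IsOpen {s : ℂ | 1 - η < s.re} := ClassicalZFRData.isOpen_dom η
  have hG' : DifferentiableOn ℂ (deriv G) {s : ℂ | 1 - η < s.re} :=
    (h.differentiableOn.analyticOnNhd hopen).deriv.differentiableOn
  refine ⟨c₀, C, hc₀pos, h.nonneg, h.summable, fun s hs ↦ ?_, fun s hs ↦ ?_, fun s hs ↦ ?_⟩
  · rw [h.logDeriv_eq s hs]; ring
  · obtain ⟨h1, h2⟩ := hsub s hs
    have hne := (hreg s h1 h2).1
    have hmem : s ∈ {s : ℂ | 1 - η < s.re} := h1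
    have hd1 : DifferentiableAt ℂ (deriv G) s := hG'.differentiableAt (hopen.mem_nhds hmem)
    have hd2 : DifferentiableAt ℂ G s := h.differentiableOn.differentiableAt (hopen.mem_nhds hmem)
    exact ((hd1.div hd2 hne).neg).differentiableWithinAt
  · obtain ⟨h1, h2⟩ := hsub s hs
    rw [norm_neg]
    exact (hreg s h1 h2).2

/-- **The prime number theorem with de la Vallée-Poussin's error term, abstract form**
(Montgomery–Vaughan Theorem 6.9 (6.12); for `ζ_K`, Theorem 8.9 / Landau 1903 §13): under the
hypotheses `ClassicalZFRData Λ G η` of the classical zero-free-region argument there are `c > 0`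
and `C` with `|∑_{n ≤ x} Λ(n) − x| ≤ C x exp(−c √log x)` for all `x ≥ 2`.
[cite: MontgomeryVaughan2007, Theorem 6.9 (6.12)] -/
theorem abs_psi_sub_le (h : ClassicalZFRData Λ G η) :
    ∃ c' : ℝ, 0 < c' ∧ ∃ C' : ℝ, ∀ x : ℝ, 2 ≤ x →
      |(∑ n ∈ Finset.Ioc 0 ⌊x⌋₊, Λ n) - x| ≤
        C' * x * Real.exp (-c' * Real.sqrt (Real.log x)) := by
  obtain ⟨c, C, hP⟩ := h.classicalPsiData
  exact hP.abs_psi_sub_le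

end ClassicalZFRData

end Literature.NumberTheory.LFunctions
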